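import Literature.NumberTheory.EllipticCurves.DeuringGrossencharacterIdealValuesIntegral
import Literature.NumberTheory.ComplexMultiplication.EllipticUnits.RubinEulerSystem
import HarnessLib

set_option autoImplicit false

/-!
# `𝓞_K^× = {±1}` for `K = ℚ(√−7)` and the injectivity of the global units modulo Kato's moduli

Topic `NumberTheory/ComplexMultiplication/EllipticUnits` (companion of `RubinEulerSystem.lean`'s `UnitsInjectiveMod` and of
`KatoEllipticUnitRepresentatives.lean`'s `sec155_exists_katoUnitRep`, whose binder `UnitsInjectiveMod (katoModulus p 𝔣 n)` this file
discharges at `K ∋ √−7`).  Cell `bsd-cm`, seat `bsd-cm-prr-ty1` g35 (literature-prover), row K2C-15 of crux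
`stmt-BirchSwinnertonDyer-19945` (item [U1] of the CHECK line / `g35/README-successor.md`).  PROVED; no definition, no named fact.

* `units_eq_one_or_eq_neg_one_of_sq_eq_neg_seven` — in a quadratic number field `K ∋ μ`, `μ² = −7`, every unit of `𝓞_K` is `±1`
  (Cox Exercise 5.9: `𝒪_K^* = {±1}` unless `K = ℚ(i), ℚ(ω)`; here from `2ε = m + nμ` (`2·𝓞_K ⊆ ℤ + ℤμ`, tree
  `DeuringIdealValues.exists_int_int_two_mul_eq_of_sq_eq_neg_seven`) and `N(2ε) = m² + 7n² = 4`).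
* `unitsInjectiveMod_of_two_not_mem` — if every unit is `±1` and `2 ∉ 𝔪` then the units inject modulo `𝔪` (`UnitsInjectiveMod 𝔪`,
  de Shalit's `w_𝔪 = 1`); `two_not_mem_of_le_of_seven_mem` — `2 ∉ 𝔪` as soon as `𝔪 ≤ 𝔮 ∌ 1` with `7 ∈ 𝔮` (`7 − 3·2 = 1`);
  ★ `unitsInjectiveMod_of_sq_eq_neg_seven` — the combination.

HONEST LABEL: elementary; stmt-19945 OPEN; no summit statement is proved by this seat; BSD is claimed for no curve.

References: [Cox2013] §5 Exercise 5.9 and §7.D Thm. 7.24 (`𝒪_K^*`); [deShalit1987] II.1.1 (`w_𝔣`, the number of roots of unity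
congruent to 1 mod 𝔣) and II.2.4; [Kato2004Asterisque] §15.5 (p. 253).
-/

noncomputable section

open scoped NumberField
open NumberField

namespace Literature.NumberTheory.ComplexMultiplication.EllipticUnits.UnitsSqrtNegSeven

open Literature.NumberTheory.EllipticCurves.DeuringIdealValues

variable {K : Type} [Field K] [NumberField K]

/-- ★ **`𝓞_K^× = {±1}` for a quadratic number field `K ∋ μ` with `μ² = −7`.** [cite: Cox2013, §5 Exercise 5.9 and §7.D Thm. 7.24] -/
theorem units_eq_one_or_eq_neg_one_of_sq_eq_neg_seven (h2 : Module.finrank ℚ K = 2) {μ : K} (hμ : μ ^ 2 = -7)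
    (ε : (𝓞 K)ˣ) : ε = 1 ∨ ε = -1 := by
  obtain ⟨m, n, hmn⟩ := exists_int_int_two_mul_eq_of_sq_eq_neg_seven h2 hμ (ε : 𝓞 K)
  -- the norm of a unit is `±1`
  have hN1 : Algebra.norm ℤ ((ε : 𝓞 K)) = 1 ∨ Algebra.norm ℤ ((ε : 𝓞 K)) = -1 :=
    Int.isUnit_iff.mp ((Units.isUnit ε).map (Algebra.norm ℤ))
  -- `N(ε) = (m/2)² + 7 (n/2)²`
  have hε : ((ε : 𝓞 K) : K) = algebraMap ℚ K ((m : ℚ) / 2) + algebraMap ℚ K ((n : ℚ) / 2) * μ := by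
    rw [map_div₀, map_div₀, map_intCast, map_intCast, map_ofNat]
    linear_combination hmn / 2
  have hN : ((Algebra.norm ℤ ((ε : 𝓞 K)) : ℤ) : ℚ) = ((m : ℚ) / 2) ^ 2 + 7 * ((n : ℚ) / 2) ^ 2 := by
    rw [Algebra.coe_norm_int, hε, norm_coords_of_sq_eq_neg_seven h2 hμ]
  -- hence `m² + 7n² = 4`
  have h4 : m ^ 2 + 7 * n ^ 2 = 4 := by
    have hpos : (0 : ℚ) ≤ ((m : ℚ) / 2) ^ 2 + 7 * ((n : ℚ) / 2) ^ 2 := by positivity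
    rcases hN1 with h | h
    · have : ((m : ℚ) / 2) ^ 2 + 7 * ((n : ℚ) / 2) ^ 2 = 1 := by rw [← hN, h]; norm_num
      have h' : ((m ^ 2 + 7 * n ^ 2 : ℤ) : ℚ) = (4 : ℤ) := by push_cast; linear_combination 4 * this
      exact_mod_cast h'
    · rw [h] at hN; norm_num at hN; linarith
  have hn : n = 0 := by
    by_contra hn
    have : 1 ≤ n ^ 2 := by
      have := sq_pos_of_ne_zero hn
      omega
    nlinarith [sq_nonneg m]
  have hm : m = 2 ∨ m = -2 := by
    rw [hn] at h4
    have h0 : (m - 2) * (m + 2) = 0 := by nlinarith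
    rcases mul_eq_zero.mp h0 with h | h
    · exact Or.inl (by linarith)
    · exact Or.inr (by linarith)
  -- conclude in `K`, then in `(𝓞 K)ˣ`
  have hεK : ((ε : 𝓞 K) : K) = 1 ∨ ((ε : 𝓞 K) : K) = -1 := by
    rw [hn] at hmn
    simp only [Int.cast_zero, zero_mul, add_zero] at hmn
    rcases hm with h | h
    · left
      rw [h] at hmn; push_cast at hmn
      exact mul_left_cancel₀ (two_ne_zero' K) (by rw [hmn, mul_one])
    · right
      rw [h] at hmn; push_cast at hmn
      exact mul_left_cancel₀ (two_ne_zero' K) (by rw [hmn]; ring)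
  rcases hεK with h | h
  · left
    ext
    simp [h]
  · right
    ext
    simp [h]

omit [NumberField K] in
/-- **Units inject modulo `𝔪` when every unit is `±1` and `2 ∉ 𝔪`** (the differences of `±1` are `0, ±2`).
[cite: deShalit1987, II.1.1 (w_𝔣 = 1)] -/
theorem unitsInjectiveMod_of_two_not_mem (hunits : ∀ ε : (𝓞 K)ˣ, ε = 1 ∨ ε = -1) {𝔪 : Ideal (𝓞 K)}
    (h2 : (2 : 𝓞 K) ∉ 𝔪) : UnitsInjectiveMod 𝔪 := by
  intro ζ ζ' h
  rcases hunits ζ with rfl | rfl <;> rcases hunits ζ' with rfl | rfl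
  · rfl
  · exfalso; apply h2
    simpa [Units.val_neg, Units.val_one, sub_neg_eq_add, one_add_one_eq_two] using h
  · exfalso; apply h2
    have h' : (-1 : 𝓞 K) - 1 = -2 := by norm_num
    rw [Units.val_neg, Units.val_one, h'] at h
    simpa using 𝔪.neg_mem h
  · rfl

omit [NumberField K] in
/-- **`2 ∉ 𝔪` whenever `𝔪 ≤ 𝔮` for a proper ideal `𝔮 ∋ 7`** (`1 = 7 − 3·2`). [cite: Kato2004Asterisque, §15.5 (p. 253)] -/
theorem two_not_mem_of_le_of_seven_mem {𝔪 𝔮 : Ideal (𝓞 K)} (h𝔮 : 𝔮 ≠ ⊤) (h7 : (7 : 𝓞 K) ∈ 𝔮) (hle : 𝔪 ≤ 𝔮) :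
    (2 : 𝓞 K) ∉ 𝔪 := by
  intro h2
  apply h𝔮
  rw [Ideal.eq_top_iff_one]
  have h : (1 : 𝓞 K) = 7 - 3 * 2 := by norm_num
  rw [h]
  exact 𝔮.sub_mem h7 (𝔮.mul_mem_left 3 (hle h2))

/-- ★ **`UnitsInjectiveMod 𝔪` for `K ∋ √−7` and every `𝔪` inside a proper ideal containing `7`** — e.g. Kato's moduli
`katoModulus 7 𝔣 n = 7ⁿ𝔣 ≤ 𝔭₇` when `𝔭₇ ∣ 𝔣` (the `sec155_exists_katoUnitRep` binder at `ℚ(√−7)`).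
[cite: deShalit1987, II.1.1 (w_𝔣 = 1)] [cite: Cox2013, §5 Exercise 5.9] -/
theorem unitsInjectiveMod_of_sq_eq_neg_seven (h2 : Module.finrank ℚ K = 2) {μ : K} (hμ : μ ^ 2 = -7)
    {𝔪 𝔮 : Ideal (𝓞 K)} (h𝔮 : 𝔮 ≠ ⊤) (h7 : (7 : 𝓞 K) ∈ 𝔮) (hle : 𝔪 ≤ 𝔮) : UnitsInjectiveMod 𝔪 :=
  unitsInjectiveMod_of_two_not_mem (units_eq_one_or_eq_neg_one_of_sq_eq_neg_seven h2 hμ)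
    (two_not_mem_of_le_of_seven_mem h𝔮 h7 hle)

end Literature.NumberTheory.ComplexMultiplication.EllipticUnits.UnitsSqrtNegSeven

end
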